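import Literature.AnabelianGeometry.EtaleTheta.TemperedFrobenioidOfThetaTwistTower
import Literature.AnabelianGeometry.EtaleTheta.Discharge.Sec5OfQuotientTemperoid
import Literature.AnabelianGeometry.EtaleTheta.Discharge.Sec3Prop34iiOfGaloisCovering
import Literature.AnabelianGeometry.EtaleTheta.Discharge.Sec3Prop34Cnst0TorsionUnitsObstructionThetaTwistTower
import Literature.AnabelianGeometry.EtaleTheta.TemperedFrobenioidOfTateTowerThetaCoprimePull
import HarnessLib

/-!
# [EtTh] Prop. 1.4 (i) / Def. 3.3 (iii) at the FOURTH tower model: the theta function `θ` as a SECTION of `B₀` over the covering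
# `Y_n = Compat₃′/V_n`, the family of its polar divisors in `Φ₀(Y_n)`, and `div₀ θ = [cusps] − [D₁]` with COPRIME halves

S. Mochizuki, *The étale theta function and its Frobenioid-theoretic manifestations*, Publ. RIMS **45** (2009) [MochizukiEtTh2009], Prop. 1.4 (i)
p.247 (PDF p.21) («the zeroes of `Θ̈` on `Ÿ` are precisely the cusps of `Ÿ`; each zero has multiplicity 1. The divisor of poles of `Θ̈` on `Ÿ` is
precisely the divisor `D_1`»), Rmk. 1.3.1 p.247 (`D_1` does not descend), Def. 3.3 (iii) p.299 (PDF p.73) (`B₀(Y) = Mero(Z_∞)^{Gal(Z_∞/Y)}`,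
`Φ₀(Y) = Div⁺(Z_∞)^{Gal}`, «the log-divisor of zeroes and poles» `B₀ → Φ₀^gp`), Def. 4.1 (i) p.312 (PDF p.86) («`Div(s′)`, `Div(s″)` have disjoint
supports»), §5 p.330 (PDF p.104) («the theta function determines an element of `O^×(A_⊙^birat)`»); [FrdII] = [MochizukiFrdII2008] Ex. 1.3 (ii)
p.11; [SemiAnbd] = [MochizukiSemiAnbd2006] Rmk. 3.1.2/3.1.3 pp.33–34.  [cite: MochizukiEtTh2009, Def 3.3 (iii) p.73]
PAGE CONVENTION for [EtTh]: «printed N (PDF p.M)», N = M + 226.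

CLASS (b) DATUM (definitions + theorems; abc-iut cell, layer L2, seat abc-iut-L2-d2 gen 8; abc-iut-L2-lead R1224 / plan/L2/SUBDAG-EtTh-JUNCTION.md
slot D5 = (O6) «the Θ̈ fraction-pair / root datum at FILE 4»; FILE A1 of 2).  Consumed BY NAME, nothing restated: abc-iut-L2-t3's ε-free
tower `towerC₃sf` (levels `μ_{N_m} × ⟨ϖ̈_m⟩ × ⟨Ü_m⟩ × ⟨Θ̈_m⟩`, `TateTowerThetaTwist.theta`, `divisor_theta`), its Frobenius-trivial anchor
constructor `quotConnObj` (p496301), abc-iut-L1-t6's open normal `V_n = vSub 3 thetaShear n` / `vOpenNormal` (trivial translation, trivial data of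
index `< n`), abc-iut-w5-d034's `towerC₃sf_actFn_eq_one_of_mem_vSub` / `exists_cover_vSub` level computation, abc-iut-w6-d058's
`exists_bZero_quotient_of_invariant` / `exists_phiZero_quotient_of_invariant` (`B₀(G/H) = Mero^H`, `Φ₀(G/H) = Div⁺^H` on the nose),
abc-iut-L2-t3's `Ÿ`-skeleton calculus `thetaZerosPhi` / `actDIV_thetaZeros` / `coord` / `perfection_coprime_iff_coord` (p478021…), this seat's
FILE 4 translation character `φ₃` (p493549).
* §1 **`YV n := quotConnObj isTemperedC (vOpenNormal n)` = `Y_n = Compat₃′/V_n`** with base point `yV n`, stabiliser EXACTLY `V_n`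
  (`ρ_yV_eq_iff`), one orbit, `YV_eq_quotCoverC₃` (`rfl`), **level EXACTLY `n`** (`lvlC_YV`).
* §2 at any level `m ≤ n`: the root **`thetaFn m = Θ̈_m`**, fixed by `V_n`; **`thetaFam n m hm ∈ B₀(Y_n)`** — THE THETA FUNCTION ON `Y_n`,
  `θ(k·V_n) = k·Θ̈_m` (`thetaFam_apply_mk`); **`thetaPolesFam n m ∈ Φ₀(Y_n)`** — the family `k·V_n ↦ k·D₁` of polar divisors (`V_n` has
  trivial translation so `D₁` IS a section over `Y_n`; it never meets a cusp, `toAdd_thetaPolesFam_inl`); `thetaZerosFam` = `thetaZerosPhi`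
  (the cusps; never meets a component); **`divZeroHom_thetaFam : div₀ θ = [zeros]/[poles]`**; the two families have DISJOINT coordinate
  supports (`coord_thetaZerosFam_eq_one_or`), hence COPRIME classes in `Φ₀(Y_n)^pf` (`perfection_coprime_thetaZerosFam`).
FILE A2 (`ThetaFractionPairOfThetaTwistTower`) reads this at the covering's own level `lvl Y_n = n` and builds `Θ̈ ∈ O^×(A_⊙^birat)` and its
Def. 4.1 (i) fraction-pair.  HONEST FRAMING: class-(b) combinatorial DESIGN model (finite groups of roots of unity adjoined level-wise to the
`Ÿ`-skeleton; (β) deviation of record: the torsion sign of Prop. 1.4 (ii) is not carried), NOT the tempered Frobenioid of a Tate curve; no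
Prop-valued fact, no instance, no notation, no sorry; nothing here bears on [IUTchIII] Cor. 3.12; no side taken; typed ≠ proved.
-/

noncomputable section

namespace Literature.AnabelianGeometry.EtaleTheta

open CategoryTheory Opposite Function Literature.AlgebraicGeometry.Frobenioids Literature.AlgebraicGeometry.Frobenioids.QuasiTemperoid
  Literature.AnabelianGeometry.SemiGraphs LogDivisorModel LogDivisorModel.GaloisAction LogDivisorTower

namespace ThetaTwistTowerTempered

open LogDivisorModel.TateTowerThetaTwist TateTowerKummerTwistRShear
open TateTowerKummerTwist (N coe_N N_dvd_M eN eN_pos)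

/-! ## §1 The covering `Y_n := Compat₃′/V_n`: base point, stabiliser `V_n`, level exactly `n` -/

/-- **`Y_n := Compat₃′/V_n`** as an object of `B^temp(Compat₃′)⁰` (abc-iut-L2-t3's `quotConnObj` at abc-iut-L1-t6's open normal `V_n`).
[cite: MochizukiEtTh2009, Def 4.1 p.86] -/
def YV (n : ℕ) : ConnectedPart (BTemp (Compat 3 thetaShear)) :=
  TemperedFrobenioid.quotConnObj (isTemperedC 3 thetaShear) (vOpenNormal 3 thetaShear n)

/-- The base point `1·V_n` of `Y_n`. [cite: MochizukiEtTh2009, Def 4.1 p.86] -/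
def yV (n : ℕ) : (gset (YV n)).V := ((1 : Compat 3 thetaShear) : Compat 3 thetaShear ⧸ vSub 3 thetaShear n)

/-- The underlying `Compat₃′`-set of `Y_n` is the coset space (definitionally). [cite: MochizukiFrdII2008, Ex 1.3 (ii) p.11] -/
theorem gset_YV (n : ℕ) : gset (YV n) = Action.ofMulAction (Compat 3 thetaShear) (Compat 3 thetaShear ⧸ vSub 3 thetaShear n) := rfl

/-- The action on the base point: `k · V_n = k V_n`. [cite: MochizukiFrdII2008, Ex 1.3 (ii) p.11] -/
theorem ρ_yV (n : ℕ) (k : Compat 3 thetaShear) : (gset (YV n)).ρ k (yV n) = (k : Compat 3 thetaShear ⧸ vSub 3 thetaShear n) :=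
  GaloisObjects.quotientObj_ρ_one (isTemperedC 3 thetaShear) _ (vOpenNormal 3 thetaShear n).isOpen' k

/-- **The stabiliser of the base point of `Y_n` is `V_n`.** [cite: MochizukiFrdII2008, Ex 1.3 (ii) p.11] -/
theorem ρ_yV_eq_iff (n : ℕ) (k : Compat 3 thetaShear) : (gset (YV n)).ρ k (yV n) = yV n ↔ k ∈ vSub 3 thetaShear n :=
  GaloisObjects.quotientObj_ρ_one_eq_iff (isTemperedC 3 thetaShear) _ (vOpenNormal 3 thetaShear n).isOpen' k

/-- `Y_n` is one orbit through its base point. [cite: MochizukiFrdII2008, Ex 1.3 (ii) p.11] -/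
theorem exists_ρ_yV_eq (n : ℕ) (y : (gset (YV n)).V) : ∃ k : Compat 3 thetaShear, (gset (YV n)).ρ k (yV n) = y :=
  GaloisObjects.quotientObj_transitive (isTemperedC 3 thetaShear) _ (vOpenNormal 3 thetaShear n).isOpen' y

/-- `Y_n` IS abc-iut-w5-d034's / abc-iut-L2-t3's `quotCoverC₃ V_n` (definitionally). [cite: MochizukiFrdII2008, Ex 1.3 (ii) p.11] -/
theorem YV_eq_quotCoverC₃ (n : ℕ) :
    YV n = quotCoverC₃ (vSub 3 thetaShear n) (isOpen_vSub 3 thetaShear n) (countable_quotient_vSub 3 thetaShear n) := rfl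

/-- **`Y_n` has level EXACTLY `n`** (`Δ_n ∩ Compat ⊆ V_n` fixes every coset; `V_n ⊆ kumLevelC₃ n`). [cite: MochizukiEtTh2009, Def 3.3 (ii) p.73] -/
theorem lvlC_YV (n : ℕ) : lvlC 3 thetaShear (YV n) = n := by
  refine le_antisymm (lvlC_le 3 thetaShear fun g hg y => ?_)
    (le_lvlC_quotCoverC₃ _ (isOpen_vSub 3 thetaShear n) (countable_quotient_vSub 3 thetaShear n) fun g hg i hi => (hg.2 i hi).1)
  obtain ⟨k, rfl⟩ := exists_ρ_yV_eq n y
  change (gset (YV n)).ρ g ((gset (YV n)).ρ k (yV n)) = (gset (YV n)).ρ k (yV n)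
  rw [ρ_yV]
  refine (ofMulAction_quot_fix_iff₃ (vSub 3 thetaShear n) k g).2 ?_
  have h := (vSub_normal 3 thetaShear n).conj_mem g (closureC_le_vSub₃ n hg) k⁻¹
  rwa [inv_inv] at h


/-! ## §2 The root `Θ̈_m` (level `m ≤ n`), the theta family on `Y_n`, the family of its polar divisors, `div₀` -/

section Level

variable (n m : ℕ)

/-- **`Θ̈_m = (1, Θ̈)`**, the level-`m` root of the theta function: an ε-free function of the level `μ_{N_m} × ⟨ϖ̈_m⟩ × ⟨Ü_m⟩ × ⟨Θ̈_m⟩`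
(`N_m = (m+1)!`; the transitions raise to the ramification index, so `Θ̈_m` is the `N_m`-th root of `Θ̈ = Θ̈_0`).
[cite: MochizukiEtTh2009, Prop 1.4 p.21] -/
def thetaFn : (towerC₃sf.Z m).Fn := ⟨theta (TateTowerKummerTwist.MuN m), rfl⟩

/-- `Θ̈_m` is log-meromorphic (every function of the level is). [cite: MochizukiEtTh2009, Def 3.1 p.70] -/
theorem thetaFn_mem_logMero : thetaFn m ∈ (towerC₃sf.Z m).logMero := trivial

variable {n m} in
/-- **`V_n` FIXES `Θ̈_m` for `m ≤ n`** (it acts trivially on the whole level `m`). [cite: MochizukiEtTh2009, Def 3.3 (ii) p.73] -/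
theorem actFn_thetaFn_of_mem_vSub (hm : m ≤ n) {v : Compat 3 thetaShear} (hv : v ∈ vSub 3 thetaShear n) :
    (towerC₃sf.act m).actFn v (thetaFn m) = thetaFn m := by
  rw [towerC₃sf_actFn_eq_one_of_mem_vSub hm hv, MulAut.one_apply]

variable {n} in
/-- `V_n` has trivial translation, hence FIXES EVERY log-divisor of every level. [cite: MochizukiEtTh2009, Def 3.3 (ii) p.73] -/
theorem actDIV_of_mem_vSub {v : Compat 3 thetaShear} (hv : v ∈ vSub 3 thetaShear n) (d : (towerC₃sf.Z m).DIV) :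
    (towerC₃sf.act m).actDIV v d = d := by
  change TateTowerTheta.baseAction.actDIV (Multiplicative.ofAdd (Multiplicative.toAdd (v : Grp 3 thetaShear).right.2)) d = d
  rw [hv.1, toAdd_one, ofAdd_zero, map_one, MulAut.one_apply]

/-- **The divisor of `Θ̈_m` is `(all cusps, multiplicity 1) − D₁`** in level units (Prop. 1.4 (i)). [cite: MochizukiEtTh2009, Prop 1.4 p.21] -/
theorem divisor_thetaFn :
    (towerC₃sf.Z m).divisor ⟨thetaFn m, thetaFn_mem_logMero m⟩ =
      ((TateTowerTheta.thetaZeros : TateTowerTheta.model.DIV) : (towerC₃sf.Z m).DIV) /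
        ((TateTowerTheta.thetaPoles : TateTowerTheta.model.DIV) : (towerC₃sf.Z m).DIV) :=
  TateTowerThetaTwist.divisor_theta (TateTowerKummerTwist.MuN m)

/-- A section of `B₀(Y_n)` at level `m ≤ n` with value `Θ̈_m` at the base point exists (`V_n` fixes `Θ̈_m`; abc-iut-w6-d058's
`B₀(G/H) = Mero^H`). [cite: MochizukiEtTh2009, Def 3.3 (iii) p.73] -/
theorem exists_thetaFam (hm : m ≤ n) : ∃ b : (towerC₃sf.act m).bZero (gset (YV n)), b.1 (yV n) = thetaFn m :=
  (towerC₃sf.act m).exists_bZero_quotient_of_invariant (vSub 3 thetaShear n) (thetaFn_mem_logMero m)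
    fun _ hv => actFn_thetaFn_of_mem_vSub hm hv

/-- **THE THETA FUNCTION ON `Y_n`** (level `m ≤ n`): the element `θ ∈ B₀(Y_n) = Hom_{Compat₃′}(Y_n, Mero(level m))` with
`θ(k·V_n) = k·Θ̈_m` — print's `Θ̈ ∈ K_Ÿ` read on the covering `Y_n` of the fourth model (§5 p.330: «the theta function determines an
element of `O^×(A_⊙^birat)`»). [cite: MochizukiEtTh2009, §5 p.330] -/
def thetaFam (hm : m ≤ n) : (towerC₃sf.act m).bZero (gset (YV n)) := (exists_thetaFam n m hm).choose

/-- `θ(V_n) = Θ̈_m`. [cite: MochizukiEtTh2009, §5 p.330] -/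
theorem thetaFam_apply_yV (hm : m ≤ n) : (thetaFam n m hm).1 (yV n) = thetaFn m := (exists_thetaFam n m hm).choose_spec

/-- **`θ(k·V_n) = k·Θ̈_m`** for every `k ∈ Compat₃′`. [cite: MochizukiEtTh2009, §5 p.330] -/
theorem thetaFam_apply_mk (hm : m ≤ n) (k : Compat 3 thetaShear) :
    (thetaFam n m hm).1 (k : Compat 3 thetaShear ⧸ vSub 3 thetaShear n) = (towerC₃sf.act m).actFn k (thetaFn m) := by
  rw [← thetaFam_apply_yV n m hm]
  exact (towerC₃sf.act m).bZero_quotient_apply (vSub 3 thetaShear n) (thetaFam n m hm) k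

/-- A section of `Φ₀(Y_n)` (level `m`) with value `D₁` at the base point exists (`V_n` has trivial translation).
[cite: MochizukiEtTh2009, Def 3.3 (iii) p.73] -/
theorem exists_thetaPolesFam : ∃ φ : (towerC₃sf.act m).phiZero (gset (YV n)),
    φ.1 (yV n) = ((TateTowerTheta.thetaPoles : TateTowerTheta.model.DIV) : (towerC₃sf.Z m).DIV) :=
  (towerC₃sf.act m).exists_phiZero_quotient_of_invariant (vSub 3 thetaShear n)
    (d := ((TateTowerTheta.thetaPoles : TateTowerTheta.model.DIV) : (towerC₃sf.Z m).DIV))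
    ⟨trivial, TateTowerTheta.thetaPoles.2⟩ fun _ hv => actDIV_of_mem_vSub m hv _

/-- **THE FAMILY OF POLAR DIVISORS of `θ` on `Y_n`** (level `m`): the element of `Φ₀(Y_n) = Hom_{Compat₃′}(Y_n, Div⁺)` with value `k·D₁`
at `k·V_n` (`D₁` does not descend below the coverings on which the translation acts trivially, Rmk. 1.3.1 — it IS a section over `Y_n`).
[cite: MochizukiEtTh2009, Prop 1.4 p.21] -/
def thetaPolesFam : (towerC₃sf.act m).phiZero (gset (YV n)) := (exists_thetaPolesFam n m).choose

/-- Its value at the base point is `D₁`. [cite: MochizukiEtTh2009, Prop 1.4 p.21] -/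
theorem thetaPolesFam_apply_yV :
    (thetaPolesFam n m).1 (yV n) = ((TateTowerTheta.thetaPoles : TateTowerTheta.model.DIV) : (towerC₃sf.Z m).DIV) :=
  (exists_thetaPolesFam n m).choose_spec

/-- **The polar family never meets a cusp**: at `k·V_n` its value is `k·D₁`, supported on the special fibre (the translation permutes
the components). [cite: MochizukiEtTh2009, Prop 1.4 p.21] -/
theorem toAdd_thetaPolesFam_inl (y : (gset (YV n)).V) (c : TateTowerTheta.Cusp) :
    Multiplicative.toAdd ((thetaPolesFam n m).1 y) (Sum.inl c) = 0 := by
  obtain ⟨k, rfl⟩ := exists_ρ_yV_eq n y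
  rw [(thetaPolesFam n m).2.2 k (yV n), thetaPolesFam_apply_yV]
  obtain ⟨j, b⟩ := c
  change Multiplicative.toAdd (TateTowerTheta.shiftDIV (Multiplicative.toAdd (Multiplicative.ofAdd
    (Multiplicative.toAdd (k : Grp 3 thetaShear).right.2))) (Multiplicative.ofAdd TateTowerTheta.polesFun)) (Sum.inl (j, b)) = 0
  rw [TateTowerTheta.toAdd_shiftDIV, toAdd_ofAdd, TateTowerTheta.shiftIdx_symm_inl]
  rfl

/-- **THE FAMILY OF ZERO DIVISORS of `θ` on `Y_n`** (level `m`): abc-iut-L2-t3's constant family `thetaZerosPhi` (all cusps, multiplicity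
`1`; translation-invariant) read in `Φ₀(Y_n)` of the tower's level `m` (`phiZero_act_eq`). [cite: MochizukiEtTh2009, Prop 1.4 p.21] -/
def thetaZerosFam : (towerC₃sf.act m).phiZero (gset (YV n)) := TateTowerTheta.thetaZerosPhi φ₃ (gset (YV n))

/-- Its values are the zero divisor. [cite: MochizukiEtTh2009, Prop 1.4 p.21] -/
@[simp] theorem thetaZerosFam_apply (y : (gset (YV n)).V) :
    (thetaZerosFam n m).1 y = ((TateTowerTheta.thetaZeros : TateTowerTheta.model.DIV) : (towerC₃sf.Z m).DIV) :=
  rfl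

/-- **The zero family never meets a component** (the cusps only). [cite: MochizukiEtTh2009, Prop 1.4 p.21] -/
theorem toAdd_thetaZerosFam_inr (y : (gset (YV n)).V) (j : ℤ) : Multiplicative.toAdd ((thetaZerosFam n m).1 y) (Sum.inr j) = 0 := rfl

/-- The divisor of `θ` at the base point is `div Θ̈_m = (cusps) − D₁`. [cite: MochizukiEtTh2009, Prop 1.4 p.21] -/
theorem divAt_thetaFam_yV (hm : m ≤ n) : (towerC₃sf.act m).divAt (gset (YV n)) (thetaFam n m hm) (yV n) =
    ((TateTowerTheta.thetaZeros : TateTowerTheta.model.DIV) : (towerC₃sf.Z m).DIV) /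
      ((TateTowerTheta.thetaPoles : TateTowerTheta.model.DIV) : (towerC₃sf.Z m).DIV) := by
  have e : (⟨(thetaFam n m hm).1 (yV n), (thetaFam n m hm).2.1 (yV n)⟩ : (towerC₃sf.Z m).logMero) = ⟨thetaFn m, thetaFn_mem_logMero m⟩ :=
    Subtype.ext (thetaFam_apply_yV n m hm)
  rw [divAt, e]
  exact divisor_thetaFn m

/-- **`div₀ θ = [zeros] / [poles]` in `Φ₀(Y_n)^gp`** — Def. 3.3 (iii)'s «log-divisor of zeroes and poles» of the theta function:
numerator the (constant) family of cusps, denominator the family of translates of `D₁`. [cite: MochizukiEtTh2009, Def 3.3 (iii) p.73] -/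
theorem divZeroHom_thetaFam (hm : m ≤ n) : (towerC₃sf.act m).divZeroHom (gset (YV n)) (thetaFam n m hm) =
    Algebra.GrothendieckGroup.of (thetaZerosFam n m) / Algebra.GrothendieckGroup.of (thetaPolesFam n m) := by
  refine ((towerC₃sf.act m).divZeroHom_eq_div_iff _ _ _ _).2 fun y => ?_
  obtain ⟨k, rfl⟩ := exists_ρ_yV_eq n y
  rw [divAt_ρ, (thetaPolesFam n m).2.2 k (yV n), thetaPolesFam_apply_yV, divAt_thetaFam_yV, thetaZerosFam_apply, ← map_mul]
  have h : ((TateTowerTheta.thetaZeros : TateTowerTheta.model.DIV) : (towerC₃sf.Z m).DIV) /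
      ((TateTowerTheta.thetaPoles : TateTowerTheta.model.DIV) : (towerC₃sf.Z m).DIV) *
      ((TateTowerTheta.thetaPoles : TateTowerTheta.model.DIV) : (towerC₃sf.Z m).DIV) = TateTowerTheta.thetaZeros := div_mul_cancel _ _
  exact (congrArg ((towerC₃sf.act m).actDIV k) h).trans (TateTowerTheta.actDIV_thetaZeros φ₃ k)

/-- **The two families have DISJOINT COORDINATE SUPPORTS** (zeros on the cusps, poles on the components): at every point and every
prime log-divisor one of the two coordinates vanishes. [cite: MochizukiEtTh2009, Def 4.1 (i) p.86] -/
theorem coord_thetaZerosFam_eq_one_or (y : (gset (YV n)).V) (x : TateTowerTheta.Idx) :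
    TateTowerTheta.coord φ₃ (gset (YV n)) y x (thetaZerosFam n m) = 1 ∨
      TateTowerTheta.coord φ₃ (gset (YV n)) y x (thetaPolesFam n m) = 1 := by
  rcases x with c | j
  · refine Or.inr ?_
    change Multiplicative.ofAdd (Multiplicative.toAdd ((thetaPolesFam n m).1 y) (Sum.inl c)).toNat = 1
    rw [toAdd_thetaPolesFam_inl, Int.toNat_zero, ofAdd_zero]
  · refine Or.inl ?_
    change Multiplicative.ofAdd (Multiplicative.toAdd ((thetaZerosFam n m).1 y) (Sum.inr j)).toNat = 1
    rw [toAdd_thetaZerosFam_inr, Int.toNat_zero, ofAdd_zero]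

/-- Hence their classes in `Φ₀(Y_n)^pf` are COPRIME. [cite: MochizukiEtTh2009, Def 4.1 (i) p.86] -/
theorem perfection_coprime_thetaZerosFam (ξ : Perfection ((towerC₃sf.act m).phiZero (gset (YV n))))
    (hz : ξ ∣ Perfection.of _ (thetaZerosFam n m)) (hp : ξ ∣ Perfection.of _ (thetaPolesFam n m)) : ξ = 1 :=
  (TateTowerTheta.perfection_coprime_iff_coord φ₃ (gset (YV n)) (thetaZerosFam n m) (thetaPolesFam n m) 1 1).2
    (coord_thetaZerosFam_eq_one_or n m) ξ hz hp

end Level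

end ThetaTwistTowerTempered

end Literature.AnabelianGeometry.EtaleTheta

end
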